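import Literature.MathematicalPhysics.QuantumFieldTheory.Balaban1983to89.B9Thm311DeltaPrimeA
import Literature.MathematicalPhysics.QuantumFieldTheory.Balaban1983to89.B9Eq316TowerFlatIsOneStep

/-!
# `Balaban1983to89.B9Eq324DeltaPrimeATower` — T. Bałaban, *Propagators for lattice gauge theories in a background field*, Commun. Math. Phys.
# **99** (1985) 389–434 [Balaban1985BackgroundPropagators] (3.24)–(3.25) p. 394 with (3.19) p. 393, Thm 3.11 p. 416: **THE SITE OPERATOR
# `Δ′_{a′}(U) = Δ^η_U + Q′(U)* a′ Q′(U)` AND ITS GREEN's FUNCTION `G′(U) = (Δ′_{a′}(U))⁻¹` FOR PRINT's `k`-TH-STEP (COMPOSITE) SITE AVERAGING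
# `Q′_k(U)` ((3.19): `Q′_j(U) = Q′(Ū^{j−1})⋯Q′(U)`), AT `k = n+1` LEVELS ON THE TORUS `T_{L^{n+1}m}`** — the verbatim one-storey-up twins of
# `B9Eq3119DeltaPiCarrier.laplacePrimeA` ∕ `GpOfU` (one averaging step) for the composite `B9Eq326OperatorTower.QprimeTowerW`, their form
# identity, symmetry and positivity letters, and THE FLAT IDENTIFICATION: at `U ≡ 1` the `k`-level site operator IS the one-step site operator at
# block size `L^{n+1}`, conjugated by the site isometry of `B9Eq316TowerFlatIsOneStep`

statement-level skeleton of published theorems with citation tags; proofs where landed; nothing here is a claim about the Yang–Mills mass gap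

CITATION HEADER (lean-in-tree rule).  Audit cell `pub-balaban`, sub-cell `t4`, BINDER row NE9; filed by the row OWNER lineage `b2b-balaban-t4-ne9-p1`
(gen 85), INTENT I-ne9p1-g85-1.  Sources READ by this lineage in the held text `paper:balaban1985-cmp99-background-propagators` (journal page = PDF
page + 388): pp. 393–395, 402–403, 416.

THE PRINT (verbatim).  p. 393, (3.19): *«Q′_j(U) = Q′(Ū^{j−1}) … Q′(U)»*; p. 394, (3.24): *«Δ′_a = Δ_U + Q′*(U) a Q′(U)»*, (3.25): *«G′ = (Δ′_a)⁻¹,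
R = Δ_U G′ Q′*(Q′G′²Q′*)⁻¹Q′G′»*; p. 395: *«We do not know yet if the operators … are well defined. Assuming some regularity of the configuration
U it can be easily shown that the operator Δ′_a is positive.»*; p. 416, Thm 3.11: *«the operators Δ′_a, G′, (Q′G′²Q′*)⁻¹, Δ_a, G are positive
definite.»*

WHY THIS FILE (cell context; the owner's DIAGNOSIS D-ne9p1-g85-1, journal 2026-08-22).  PRICING-NE9 v69: of the letters of the `k`-level strong
small-field coercivity (`B9Thm311SmallFieldCoercivityTowerScaled`, (SC-k)) the ONLY one not closed at print's point `ηL^{n+1} = 1` is the `k`-level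
`R`-Lipschitz letter `C_R`.  The one-step `C_R` was closed (η-, L-, volume-free on the diagonal) by NE9 leaf-06's `B9Eq325RLipschitzClosed` through
PRINT's representation (3.25) of `R(U)` by the Green's function `G′(U)` of THIS site operator; the host's Kato-gap route
(`B9Eq368ProjectionRemainder`) cannot be level-free (its window is `∝ L^{−4(n+1)}` on the diagonal: operator norms of a second-order difference
operator against a unit-block modulus).  Porting the Green's-function route one storey up starts with the `k`-level site operator; this file
supplies it, and identifies its flat instance with the one-step object at block size `L^{n+1}` so that the flat inputs of the one-step chain
(`B9Thm311SitePrimeFormCoercive*`'s `γ♭`, `B9Eq365QGGQLowerVariational`'s `κ♭`) are consumed BY NAME at `k` levels.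

WHAT IS PROVED (sorry-free; two `def`s — the verbatim twins of the one-step letters —, no `Prop` placeholder, no inequality of the paper asserted).
* §1 **`laplacePrimeAk`** `:= Δ^η_U + a′·Q̃′_k(U)†Q̃′_k(U)` on `SiteL2K ℂ d (towerP L m (n+1)) c₀ W`, `Q̃′_k(U)` = `QprimeTowerW L m n φ U` read into the
  weight-`c₁` `L²` space of the unit lattice; `laplacePrimeAk_apply_of_ker`; **`GpOfUk`** `:= greenK (laplacePrimeAk …) hpos′`; `GpOfUk_gaugeMode`
  (`Q′_k(U)λ = 0 ⇒ G′_k(Δ^η_Uλ) = λ`); **`re_inner_laplacePrimeAk`** (`re⟪λ, Δ′_{a′,k}(U)λ⟫ = ‖D_Uλ‖² + a′‖Q̃′_k(U)λ‖²` for mutually adjoint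
  transporters); **`laplacePrimeAk_isSymmetric`**; `laplacePrimeAk_re_inner_nonneg`; **`laplacePrimeAk_pos_of_coercive`** (any displayed form
  minorant `γ·(‖D_Uλ‖² + s‖λ‖²) ≤ re⟪λ, Δ′λ⟫` with `γ, s > 0` inhabits the positivity binder `hpos′` of `GpOfUk` — at `U ≠ 1` the chain takes
  positivity from the small-field coercivity, not from a kernel clause).
* §2 THE FLAT IDENTIFICATION along `h : towerP L m (n+1) = fineP (L^{n+1}) m` (the casts `siteL2Cast` of `B9Eq316TowerFlatIsOneStep`):
  `inner_siteL2Cast`, `adjoint_comp_siteL2Cast` (generic period identity: `(A ∘ Φ′)† = Φ′⁻¹ ∘ A†`), `covLaplaceSiteK_one_conj`,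
  **`laplacePrimeAk_one_eq_oneStep : Δ′_{a′,k}(1) = Φ′⁻¹ ∘ₗ Δ′^{(L^{n+1})}_{a′}(1) ∘ₗ Φ′`**, `laplacePrimeAk_one_apply`, `re_inner_laplacePrimeAk_one_eq`,
  **`laplacePrimeAk_one_pos`** (`η ≠ 0`, `0 < a′` only — `B9Thm311DeltaPrimeA.laplacePrimeA_one_pos` at block size `L^{n+1}`), **`GpOfUk_one_apply`**
  (`G′_k(1)x = Φ′⁻¹(G′^{(L^{n+1})}(1)(Φ′x))` for ANY two positivity witnesses), `GpOfUk_one_eq_oneStep`, `Qtildek_one_eq_oneStep`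
  (`Q̃′_k(1) = Q̃′^{(L^{n+1})}(1) ∘ₗ Φ′`).
MODEL ∕ DECLARED READINGS.  (M1)–(M4) as `B9Eq326OperatorTower` (periodic lattice `T_{L^{n+1}m}`, fibre `W ≃ 𝔸` finite-dimensional, weights `c₀`,
`c₁`, transporters in the adjoint reading `adTransportW`).  (M5) positivity of `Δ′_{a′,k}(U)` at `U ≠ 1` is DISPLAYED (`hpos′`) or derived from a
DISPLAYED coercivity (§1); at `U ≡ 1` proved.  (M6) NOT HERE: the kernel clause `D_Uλ = 0 ∧ Q′_k(U)λ = 0 ⇒ λ = 0` at a general background and `k`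
levels (one step: `B9Thm311DeltaPrimeA.eq_zero_of_covDerivL2K_of_QprimeW`); (3.25) for `R_k(U)` (sequel `B9Eq325ProjFormulaTower`); any estimate.
HONEST SCOPE.  [folklore] verbatim re-typing of the chain's own (3.24)–(3.25) letters for the composite averaging + index bookkeeping along the
period identity; reproduces definitions, not estimates; NOT summit progress (cell pub-balaban: NE9 NOT PRINTED ∕ NOT PROVED, «NE9 ⇐ the named
binders»; row WALLED ON A MODEL; spine PROVED 0/9; rung (B)+1 finite T⁴ — NOT infinite volume, NOT mass gap, NOT Clay; HONEST DEPENDENCY: continuum YM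
on T⁴ ⇐ BetaPertH ∧ nine spine estimates (0/9 proved); BetaPertH ⇐ (D1) ∧ (D4) ∧ CAP+tail; G-an2-4 gates asym, D1 and NE2/3/4).  NEW file importing
`B9Thm311DeltaPrimeA` and `B9Eq316TowerFlatIsOneStep`; nothing modified.  Net new unproved facts: 0.
-/

noncomputable section

open scoped InnerProductSpace ComplexConjugate

namespace Literature.MathematicalPhysics.QuantumFieldTheory.Balaban1983to89.B9Eq324DeltaPrimeATower

open B4Sect5Torus (TSite)
open B9SectCLatticeCarrier (Bond)
open B9Eq311L2Pairing (WL2)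
open B9Eq319QprimeTorus (fineP)
open B11Eq103H1Complex (SiteL2K BondL2K covDerivL2K covDivL2K covLaplaceSiteK greenK apply_greenK greenK_apply adjoint_covDerivL2K
  inner_covDivL2K_covDerivL2K)
open B9Eq310HessianOperator (adTransportW adTransportW_apply)
open B9Eq315QTower (towerP)
open B9Eq326OperatorAssembly (QprimeW)
open B9Eq326OperatorTower (QprimeTowerW)
open B9Eq3119DeltaPiCarrier (laplacePrimeA GpOfU)
open B9Thm311DeltaPrimeA (laplacePrimeA_one_pos)
open B9Eq316TowerFlatIsOneStep (siteL2Cast siteL2Cast_rfl norm_siteL2Cast covLaplaceSiteK_one_siteL2Cast QprimeTowerW_one_eq_oneStep)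

/-! ## §1 (3.24)–(3.25) for the composite site averaging `Q′_k(U)` -/

section Tower

variable {d : ℕ} (L : ℕ) [NeZero L] (m : Fin d → ℕ) [∀ i, NeZero (m i)] (n : ℕ)
  {𝔸 : Type*} [NormedRing 𝔸] [NormedAlgebra ℂ 𝔸] [CompleteSpace 𝔸] [NormOneClass 𝔸]
  {W : Type*} [NormedAddCommGroup W] [InnerProductSpace ℂ W] [FiniteDimensional ℂ W] (φ : W ≃ₗ[ℂ] 𝔸) {c₀ : ℝ} [Fact (0 < c₀)]
  (η : ℝ) (U : Bond d (towerP L m (n + 1)) → 𝔸ˣ) {c₁ : ℝ} [Fact (0 < c₁)] (a' : ℝ)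

/-- **(3.24) FOR THE COMPOSITE SITE AVERAGING: `Δ′_{a′,k}(U) := Δ^η_U + Q̃′_k(U)† a′ Q̃′_k(U)`** on the `L²` gauge parameters of `T_{L^{n+1}m}`:
`Δ^η_U = D*_U D_U` (`covLaplaceSiteK`) plus the penalty, with `Q̃′_k(U)` = `B9Eq326OperatorTower.QprimeTowerW L m n φ U` (print's `Q′_{n+1}(U)`,
(3.19)) read into the weight-`c₁` `L²` space of the unit lattice and `Q′* := Q′†` — the verbatim twin of `B9Eq3119DeltaPiCarrier.laplacePrimeA`.
[cite: Balaban1985BackgroundPropagators, (3.24) p.394, (3.19) p.393] -/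
def laplacePrimeAk : SiteL2K ℂ d (towerP L m (n + 1)) c₀ W →ₗ[ℂ] SiteL2K ℂ d (towerP L m (n + 1)) c₀ W :=
  covLaplaceSiteK ((η : ℂ))⁻¹ (adTransportW φ U) (adTransportW φ fun b => (U b)⁻¹) +
    (a' : ℂ) • (LinearMap.adjoint ((WL2.linearEquiv ℂ ℂ (fun _ : TSite d m => c₁)).symm.toLinearMap ∘ₗ QprimeTowerW L m n φ U) ∘ₗ
      ((WL2.linearEquiv ℂ ℂ (fun _ : TSite d m => c₁)).symm.toLinearMap ∘ₗ QprimeTowerW L m n φ U))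

omit [NormOneClass 𝔸] in
/-- On `N(Q′_k(U))` the penalty vanishes: `Δ′_{a′,k}λ = Δ^η_Uλ` for `Q′_k(U)λ = 0`. [cite: Balaban1985BackgroundPropagators, (3.24)–(3.25) p.394] -/
theorem laplacePrimeAk_apply_of_ker {l : SiteL2K ℂ d (towerP L m (n + 1)) c₀ W} (hl : QprimeTowerW L m n φ U l = 0) :
    laplacePrimeAk L m n φ η U a' (c₁ := c₁) l = covLaplaceSiteK ((η : ℂ))⁻¹ (adTransportW φ U) (adTransportW φ fun b => (U b)⁻¹) l := by
  simp only [laplacePrimeAk, LinearMap.add_apply, LinearMap.smul_apply, LinearMap.comp_apply, hl, map_zero, smul_zero, add_zero]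

variable (hpos' : ∀ x : SiteL2K ℂ d (towerP L m (n + 1)) c₀ W, x ≠ 0 → 0 < RCLike.re ⟪x, laplacePrimeAk L m n φ η U a' (c₁ := c₁) x⟫_ℂ)

/-- **(3.25) `G′_k := (Δ′_{a′,k}(U))⁻¹` CONSTRUCTED** (`B11Eq103H1Complex.greenK`) from the DISPLAYED positivity of `Δ′_{a′,k}(U)` — the verbatim twin
of `B9Eq3119DeltaPiCarrier.GpOfU`. [cite: Balaban1985BackgroundPropagators, (3.25) p.394, Thm 3.11 p.416] -/
def GpOfUk : SiteL2K ℂ d (towerP L m (n + 1)) c₀ W →ₗ[ℂ] SiteL2K ℂ d (towerP L m (n + 1)) c₀ W :=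
  greenK (laplacePrimeAk L m n φ η U a' (c₁ := c₁)) hpos'

omit [NormOneClass 𝔸] in
/-- (g5) for the constructed `G′_k`: `Q′_k(U)λ = 0 → G′_k(Δ^η_U λ) = λ`. [cite: Balaban1985BackgroundPropagators, (3.24)–(3.25) p.394] -/
theorem GpOfUk_gaugeMode (l : SiteL2K ℂ d (towerP L m (n + 1)) c₀ W) (hl : QprimeTowerW L m n φ U l = 0) :
    GpOfUk L m n φ η U a' hpos' (covLaplaceSiteK ((η : ℂ))⁻¹ (adTransportW φ U) (adTransportW φ fun b => (U b)⁻¹) l) = l := by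
  rw [GpOfUk, ← laplacePrimeAk_apply_of_ker L m n φ η U a' (c₁ := c₁) hl, greenK_apply]

omit [NormOneClass 𝔸] in
/-- **THE QUADRATIC FORM of (3.24) at `k` levels: `re⟪λ, Δ′_{a′,k}(U)λ⟫ = ‖D_Uλ‖² + a′‖Q̃′_k(U)λ‖²`** for mutually adjoint transporters
(`D*_U = D_U†`, `B11Eq103H1Complex.inner_covDivL2K_covDerivL2K`) — the verbatim twin of `B9Thm311DeltaPrimeA.re_inner_laplacePrimeA`.
[cite: Balaban1985BackgroundPropagators, (3.23)–(3.24) p.394] -/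
theorem re_inner_laplacePrimeAk
    (hRS : ∀ (b : Bond d (towerP L m (n + 1))) (v u : W), ⟪adTransportW φ U b v, u⟫_ℂ = ⟪v, adTransportW φ (fun b => (U b)⁻¹) b u⟫_ℂ)
    (x : SiteL2K ℂ d (towerP L m (n + 1)) c₀ W) :
    RCLike.re ⟪x, laplacePrimeAk L m n φ η U a' (c₁ := c₁) x⟫_ℂ =
      ‖covDerivL2K ℂ c₀ ((η : ℂ))⁻¹ (adTransportW φ U) x‖ ^ 2 +
        a' * ‖((WL2.linearEquiv ℂ ℂ (fun _ : TSite d m => c₁)).symm.toLinearMap ∘ₗ QprimeTowerW L m n φ U) x‖ ^ 2 := by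
  have hc : conj (((η : ℂ))⁻¹) = ((η : ℂ))⁻¹ := by rw [map_inv₀, Complex.conj_ofReal]
  rw [laplacePrimeAk, LinearMap.add_apply, inner_add_right, map_add]
  congr 1
  · rw [covLaplaceSiteK, LinearMap.comp_apply, inner_covDivL2K_covDerivL2K _ hc _ _ hRS]
    norm_cast
  · rw [LinearMap.smul_apply, inner_smul_right, LinearMap.comp_apply, LinearMap.adjoint_inner_right, ← inner_self_eq_norm_sq (𝕜 := ℂ),
      RCLike.re_to_complex, RCLike.re_to_complex, Complex.re_ofReal_mul]

omit [NormOneClass 𝔸] in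
/-- **`Δ′_{a′,k}(U)` IS SYMMETRIC** for mutually adjoint transporters (`Δ^η_U = D_U†D_U`, `B11Eq103H1Complex.adjoint_covDerivL2K`; real `a′`) — the
verbatim twin of `B9Eq325ProjFormula.laplacePrimeA_isSymmetric`. [cite: Balaban1985BackgroundPropagators, (3.23)–(3.24) p.394, p.395] -/
theorem laplacePrimeAk_isSymmetric
    (hRS : ∀ (b : Bond d (towerP L m (n + 1))) (v u : W), ⟪adTransportW φ U b v, u⟫_ℂ = ⟪v, adTransportW φ (fun b => (U b)⁻¹) b u⟫_ℂ) :
    (laplacePrimeAk L m n φ η U a' (c₀ := c₀) (c₁ := c₁)).IsSymmetric := by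
  have hc : conj (((η : ℂ))⁻¹) = ((η : ℂ))⁻¹ := by rw [map_inv₀, Complex.conj_ofReal]
  intro x y
  simp only [laplacePrimeAk, covLaplaceSiteK, LinearMap.add_apply, LinearMap.smul_apply, LinearMap.comp_apply, inner_add_left,
    inner_add_right, inner_smul_left, inner_smul_right, Complex.conj_ofReal]
  rw [← adjoint_covDerivL2K _ hc _ _ hRS, LinearMap.adjoint_inner_left, LinearMap.adjoint_inner_right, LinearMap.adjoint_inner_left,
    LinearMap.adjoint_inner_right]
  simp only [LinearMap.comp_apply]

omit [NormOneClass 𝔸] in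
/-- `0 ≤ re⟪λ, Δ′_{a′,k}(U)λ⟫` for mutually adjoint transporters and `0 ≤ a′`. [cite: Balaban1985BackgroundPropagators, (3.24) p.394, p.395] -/
theorem laplacePrimeAk_re_inner_nonneg (ha : 0 ≤ a')
    (hRS : ∀ (b : Bond d (towerP L m (n + 1))) (v u : W), ⟪adTransportW φ U b v, u⟫_ℂ = ⟪v, adTransportW φ (fun b => (U b)⁻¹) b u⟫_ℂ)
    (x : SiteL2K ℂ d (towerP L m (n + 1)) c₀ W) :
    0 ≤ RCLike.re ⟪x, laplacePrimeAk L m n φ η U a' (c₁ := c₁) x⟫_ℂ := by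
  rw [re_inner_laplacePrimeAk L m n φ η U a' hRS]
  positivity

omit [NormOneClass 𝔸] in
/-- **POSITIVITY FROM A DISPLAYED COERCIVITY**: any form minorant `γ·(‖D_Uλ‖² + s·‖λ‖²) ≤ re⟪λ, Δ′_{a′,k}(U)λ⟫` with `0 < γ`, `0 < s` (the shape in
which the chain's small-field strong coercivity of the site operator is stated — `B9Thm311SitePrimeFormCoerciveCanonical`, one storey up) inhabits
the positivity binder `hpos′` of `GpOfUk`: print's «Δ′_a … positive definite» at `U ≠ 1` taken from the window, not from a kernel clause.
[cite: Balaban1985BackgroundPropagators, Thm 3.11 p.416, (3.24)–(3.25) p.394] -/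
theorem laplacePrimeAk_pos_of_coercive {γ s : ℝ} (hγ : 0 < γ) (hs : 0 < s)
    (hcoer : ∀ x : SiteL2K ℂ d (towerP L m (n + 1)) c₀ W,
      γ * (‖covDerivL2K ℂ c₀ ((η : ℂ))⁻¹ (adTransportW φ U) x‖ ^ 2 + s * ‖x‖ ^ 2) ≤
        RCLike.re ⟪x, laplacePrimeAk L m n φ η U a' (c₁ := c₁) x⟫_ℂ)
    (x : SiteL2K ℂ d (towerP L m (n + 1)) c₀ W) (hx : x ≠ 0) :
    0 < RCLike.re ⟪x, laplacePrimeAk L m n φ η U a' (c₁ := c₁) x⟫_ℂ := by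
  have hx' : 0 < ‖x‖ := norm_pos_iff.2 hx
  have h1 : 0 < γ * (‖covDerivL2K ℂ c₀ ((η : ℂ))⁻¹ (adTransportW φ U) x‖ ^ 2 + s * ‖x‖ ^ 2) := by
    have : 0 < s * ‖x‖ ^ 2 := by positivity
    have : 0 ≤ ‖covDerivL2K ℂ c₀ ((η : ℂ))⁻¹ (adTransportW φ U) x‖ ^ 2 := by positivity
    positivity
  exact h1.trans_le (hcoer x)

omit [NormOneClass 𝔸] in
/-- The plain coercive shape `γ‖λ‖² ≤ re⟪λ, Δ′_{a′,k}(U)λ⟫`, `0 < γ`, inhabits `hpos′` as well. [cite: Balaban1985BackgroundPropagators, Thm 3.11 p.416] -/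
theorem laplacePrimeAk_pos_of_coercive' {γ : ℝ} (hγ : 0 < γ)
    (hcoer : ∀ x : SiteL2K ℂ d (towerP L m (n + 1)) c₀ W, γ * ‖x‖ ^ 2 ≤ RCLike.re ⟪x, laplacePrimeAk L m n φ η U a' (c₁ := c₁) x⟫_ℂ)
    (x : SiteL2K ℂ d (towerP L m (n + 1)) c₀ W) (hx : x ≠ 0) :
    0 < RCLike.re ⟪x, laplacePrimeAk L m n φ η U a' (c₁ := c₁) x⟫_ℂ :=
  (mul_pos hγ (by positivity : 0 < ‖x‖ ^ 2)).trans_le (hcoer x)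

end Tower

/-! ## §2 The flat identification: `Δ′_{a′,k}(1)` IS the one-step `Δ′_{a′}(1)` at block size `L^{n+1}`, conjugated by the site isometry -/

section Cast

variable {d : ℕ} {P P' : Fin d → ℕ} {c₀ : ℝ} [Fact (0 < c₀)] {W : Type*} [NormedAddCommGroup W] [InnerProductSpace ℂ W]

/-- The site `L²` cast preserves scalar products. [cite: Balaban1985BackgroundPropagators, (3.11) p.392] -/
@[simp] theorem inner_siteL2Cast (h : P = P') (l l' : SiteL2K ℂ d P c₀ W) : ⟪siteL2Cast ℂ h l, siteL2Cast ℂ h l'⟫_ℂ = ⟪l, l'⟫_ℂ := by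
  subst h; rfl

/-- `⟪Φ′ l, z⟫ = ⟪l, Φ′⁻¹ z⟫` (the cast is unitary). [cite: Balaban1985BackgroundPropagators, (3.11) p.392] -/
theorem inner_siteL2Cast_left (h : P = P') (l : SiteL2K ℂ d P c₀ W) (z : SiteL2K ℂ d P' c₀ W) :
    ⟪siteL2Cast ℂ h l, z⟫_ℂ = ⟪l, (siteL2Cast ℂ h).symm z⟫_ℂ := by
  subst h; rfl

variable [FiniteDimensional ℂ W]

/-- **Adjoints along a period identity**: `(A ∘ Φ′)† = Φ′⁻¹ ∘ A†` for the (unitary) site cast `Φ′` and any `A` into a finite-dimensional Hilbert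
space. [folklore] [cite: Balaban1985BackgroundPropagators, (3.11) p.392] -/
theorem adjoint_comp_siteL2Cast {F : Type*} [NormedAddCommGroup F] [InnerProductSpace ℂ F] [FiniteDimensional ℂ F] (h : P = P')
    (A : SiteL2K ℂ d P' c₀ W →ₗ[ℂ] F) :
    LinearMap.adjoint (A ∘ₗ (siteL2Cast ℂ h).toLinearMap) = (siteL2Cast ℂ h).symm.toLinearMap ∘ₗ LinearMap.adjoint A := by
  subst h
  simp only [siteL2Cast_rfl, LinearEquiv.refl_toLinearMap, LinearMap.comp_id, LinearEquiv.refl_symm, LinearMap.id_comp]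

variable {𝔸 : Type*} [NormedRing 𝔸] [NormedAlgebra ℂ 𝔸] (φ : W ≃ₗ[ℂ] 𝔸)

omit [FiniteDimensional ℂ W] in
/-- **The flat site Laplacian conjugated**: `Φ′⁻¹ ∘ Δ^η_1 ∘ Φ′ = Δ^η_1` across the two typings. [cite: Balaban1985BackgroundPropagators, (3.23) p.394] -/
theorem covLaplaceSiteK_one_conj (h : P = P') (c : ℂ) :
    (siteL2Cast ℂ h).symm.toLinearMap ∘ₗ
        covLaplaceSiteK c (adTransportW φ (fun _ : Bond d P' => (1 : 𝔸ˣ))) (adTransportW φ fun _ : Bond d P' => (1 : 𝔸ˣ)⁻¹) ∘ₗ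
          (siteL2Cast ℂ h).toLinearMap =
      (covLaplaceSiteK c (adTransportW φ (fun _ : Bond d P => (1 : 𝔸ˣ))) (adTransportW φ fun _ : Bond d P => (1 : 𝔸ˣ)⁻¹) :
        SiteL2K ℂ d P c₀ W →ₗ[ℂ] SiteL2K ℂ d P c₀ W) := by
  subst h
  simp only [siteL2Cast_rfl, LinearEquiv.refl_toLinearMap, LinearMap.comp_id, LinearEquiv.refl_symm, LinearMap.id_comp]

end Cast

section Flat

variable {d : ℕ} (L : ℕ) [NeZero L] (m : Fin d → ℕ) [∀ i, NeZero (m i)] (n : ℕ)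
  {𝔸 : Type*} [NormedRing 𝔸] [NormedAlgebra ℂ 𝔸] [CompleteSpace 𝔸] [NormOneClass 𝔸]
  {W : Type*} [NormedAddCommGroup W] [InnerProductSpace ℂ W] [FiniteDimensional ℂ W] (φ : W ≃ₗ[ℂ] 𝔸) {c₀ : ℝ} [Fact (0 < c₀)]
  (η : ℝ) {c₁ : ℝ} [Fact (0 < c₁)] (a' : ℝ) (h : towerP L m (n + 1) = fineP (L ^ (n + 1)) m)

omit [NormOneClass 𝔸] [FiniteDimensional ℂ W] [Fact (0 < c₀)] [Fact (0 < c₁)] in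
/-- **`Q̃′_k(1) = Q̃′^{(L^{n+1})}(1) ∘ Φ′`** — the weight-`c₁` reading of `B9Eq316TowerFlatIsOneStep.QprimeTowerW_one_eq_oneStep`.
[cite: Balaban1985BackgroundPropagators, (3.19) p.393; Balaban1984PropagatorsI, (1.18) p.20] -/
theorem Qtildek_one_eq_oneStep :
    (WL2.linearEquiv ℂ ℂ (fun _ : TSite d m => c₁)).symm.toLinearMap ∘ₗ
        QprimeTowerW L m n φ (fun _ : Bond d (towerP L m (n + 1)) => (1 : 𝔸ˣ)) (c₀ := c₀) =
      ((WL2.linearEquiv ℂ ℂ (fun _ : TSite d m => c₁)).symm.toLinearMap ∘ₗ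
          QprimeW (L ^ (n + 1)) m φ (fun _ : Bond d (fineP (L ^ (n + 1)) m) => (1 : 𝔸ˣ)) (c₀ := c₀)) ∘ₗ
        (siteL2Cast ℂ h).toLinearMap := by
  rw [QprimeTowerW_one_eq_oneStep L m n φ h, LinearMap.comp_assoc]

omit [NormOneClass 𝔸] in
/-- **MAIN — `Δ′_{a′,k}(1) = Φ′⁻¹ ∘ Δ′^{(L^{n+1})}_{a′}(1) ∘ Φ′`**: at the flat background the `k`-level site operator (3.24) IS the one-step site
operator at block size `L^{n+1}` (`B9Eq3119DeltaPiCarrier.laplacePrimeA (L^{n+1}) m φ η 1 a′`), conjugated by the site isometry — the flat composite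
site averaging is the block mean of side `L^{n+1}` (`QprimeTowerW_one_eq_oneStep`), the flat Laplacian does not see the typing, `(A∘Φ′)† = Φ′⁻¹A†`.
[cite: Balaban1985BackgroundPropagators, (3.24) p.394, (3.19) p.393; Balaban1984PropagatorsI, (1.18) p.20] -/
theorem laplacePrimeAk_one_eq_oneStep :
    laplacePrimeAk L m n φ η (fun _ : Bond d (towerP L m (n + 1)) => (1 : 𝔸ˣ)) a' (c₀ := c₀) (c₁ := c₁) =
      (siteL2Cast ℂ h).symm.toLinearMap ∘ₗ
        laplacePrimeA (L ^ (n + 1)) m φ η (fun _ : Bond d (fineP (L ^ (n + 1)) m) => (1 : 𝔸ˣ)) a' (c₀ := c₀) (c₁ := c₁) ∘ₗ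
          (siteL2Cast ℂ h).toLinearMap := by
  have hΔ := covLaplaceSiteK_one_conj (P := towerP L m (n + 1)) (P' := fineP (L ^ (n + 1)) m) (c₀ := c₀) (W := W) φ h ((η : ℂ))⁻¹
  apply LinearMap.ext
  intro x
  have hΔx := LinearMap.congr_fun hΔ x
  simp only [LinearMap.comp_apply, LinearEquiv.coe_toLinearMap] at hΔx
  rw [laplacePrimeAk, laplacePrimeA, Qtildek_one_eq_oneStep L m n φ h, adjoint_comp_siteL2Cast h]
  simp only [LinearMap.add_apply, LinearMap.smul_apply, LinearMap.comp_apply, LinearEquiv.coe_toLinearMap, map_add, map_smul, hΔx]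

omit [NormOneClass 𝔸] in
/-- Pointwise: `Δ′_{a′,k}(1)λ = Φ′⁻¹(Δ′^{(L^{n+1})}_{a′}(1)(Φ′λ))`. [cite: Balaban1985BackgroundPropagators, (3.24) p.394] -/
theorem laplacePrimeAk_one_apply (l : SiteL2K ℂ d (towerP L m (n + 1)) c₀ W) :
    laplacePrimeAk L m n φ η (fun _ : Bond d (towerP L m (n + 1)) => (1 : 𝔸ˣ)) a' (c₁ := c₁) l =
      (siteL2Cast ℂ h).symm (laplacePrimeA (L ^ (n + 1)) m φ η (fun _ : Bond d (fineP (L ^ (n + 1)) m) => (1 : 𝔸ˣ)) a' (c₁ := c₁)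
        (siteL2Cast ℂ h l)) := by
  rw [laplacePrimeAk_one_eq_oneStep L m n φ η a' h]; rfl

omit [NormOneClass 𝔸] in
/-- The flat forms agree across the typings: `⟪λ, Δ′_{a′,k}(1)λ⟫ = ⟪Φ′λ, Δ′^{(L^{n+1})}_{a′}(1)(Φ′λ)⟫`. [cite: Balaban1985BackgroundPropagators, (3.24) p.394, (3.11) p.392] -/
theorem inner_laplacePrimeAk_one_eq (l : SiteL2K ℂ d (towerP L m (n + 1)) c₀ W) :
    ⟪l, laplacePrimeAk L m n φ η (fun _ : Bond d (towerP L m (n + 1)) => (1 : 𝔸ˣ)) a' (c₁ := c₁) l⟫_ℂ =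
      ⟪siteL2Cast ℂ h l, laplacePrimeA (L ^ (n + 1)) m φ η (fun _ : Bond d (fineP (L ^ (n + 1)) m) => (1 : 𝔸ˣ)) a' (c₁ := c₁)
        (siteL2Cast ℂ h l)⟫_ℂ := by
  rw [laplacePrimeAk_one_apply L m n φ η a' h, ← inner_siteL2Cast_left]

omit [NormOneClass 𝔸] in
/-- **`Δ′_{a′,k}(1)` IS POSITIVE DEFINITE — `η ≠ 0`, `0 < a′` only** (`B9Thm311DeltaPrimeA.laplacePrimeA_one_pos` at block size `L^{n+1}` through the
identification): the positivity binder of `GpOfUk` at the flat background, DISCHARGED. [cite: Balaban1985BackgroundPropagators, Thm 3.11 p.416, p.395] -/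
theorem laplacePrimeAk_one_pos (hη : η ≠ 0) (ha : 0 < a') (x : SiteL2K ℂ d (towerP L m (n + 1)) c₀ W) (hx : x ≠ 0) :
    0 < RCLike.re ⟪x, laplacePrimeAk L m n φ η (fun _ : Bond d (towerP L m (n + 1)) => (1 : 𝔸ˣ)) a' (c₁ := c₁) x⟫_ℂ := by
  have h : towerP L m (n + 1) = fineP (L ^ (n + 1)) m := B9Eq316TowerFlatIsOneStep.towerP_eq_fineP_pow L m (n + 1)
  have hx' : siteL2Cast ℂ h x ≠ 0 := fun h0 => hx ((siteL2Cast ℂ h).map_eq_zero_iff.1 h0)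
  rw [inner_laplacePrimeAk_one_eq L m n φ η a' h]
  exact laplacePrimeA_one_pos (L ^ (n + 1)) m φ η a' hη ha _ hx'

omit [NormOneClass 𝔸] in
/-- **`G′_k(1)x = Φ′⁻¹(G′^{(L^{n+1})}(1)(Φ′x))`** for ANY two positivity witnesses: the flat `k`-level Green's function IS the one-step one at block
size `L^{n+1}`, conjugated (`greenK` of a conjugated operator; `B11Eq103H1Complex.greenK_apply`). [cite: Balaban1985BackgroundPropagators, (3.25) p.394] -/
theorem GpOfUk_one_apply
    (hposk : ∀ x : SiteL2K ℂ d (towerP L m (n + 1)) c₀ W, x ≠ 0 →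
      0 < RCLike.re ⟪x, laplacePrimeAk L m n φ η (fun _ : Bond d (towerP L m (n + 1)) => (1 : 𝔸ˣ)) a' (c₁ := c₁) x⟫_ℂ)
    (hpos1 : ∀ x : SiteL2K ℂ d (fineP (L ^ (n + 1)) m) c₀ W, x ≠ 0 →
      0 < RCLike.re ⟪x, laplacePrimeA (L ^ (n + 1)) m φ η (fun _ : Bond d (fineP (L ^ (n + 1)) m) => (1 : 𝔸ˣ)) a' (c₁ := c₁) x⟫_ℂ)
    (x : SiteL2K ℂ d (towerP L m (n + 1)) c₀ W) :
    GpOfUk L m n φ η (fun _ : Bond d (towerP L m (n + 1)) => (1 : 𝔸ˣ)) a' hposk x =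
      (siteL2Cast ℂ h).symm (GpOfU (L ^ (n + 1)) m φ η (fun _ : Bond d (fineP (L ^ (n + 1)) m) => (1 : 𝔸ˣ)) a' (c₁ := c₁) hpos1
        (siteL2Cast ℂ h x)) := by
  set y := (siteL2Cast ℂ h).symm (GpOfU (L ^ (n + 1)) m φ η (fun _ : Bond d (fineP (L ^ (n + 1)) m) => (1 : 𝔸ˣ)) a' (c₁ := c₁) hpos1
    (siteL2Cast ℂ h x)) with hy
  have hTy : laplacePrimeAk L m n φ η (fun _ : Bond d (towerP L m (n + 1)) => (1 : 𝔸ˣ)) a' (c₁ := c₁) y = x := by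
    rw [laplacePrimeAk_one_apply L m n φ η a' h, hy, LinearEquiv.apply_symm_apply, GpOfU, apply_greenK, LinearEquiv.symm_apply_apply]
  rw [GpOfUk, ← hTy, greenK_apply]

omit [NormOneClass 𝔸] in
/-- Operator form: `G′_k(1) = Φ′⁻¹ ∘ₗ G′^{(L^{n+1})}(1) ∘ₗ Φ′`. [cite: Balaban1985BackgroundPropagators, (3.25) p.394] -/
theorem GpOfUk_one_eq_oneStep
    (hposk : ∀ x : SiteL2K ℂ d (towerP L m (n + 1)) c₀ W, x ≠ 0 →
      0 < RCLike.re ⟪x, laplacePrimeAk L m n φ η (fun _ : Bond d (towerP L m (n + 1)) => (1 : 𝔸ˣ)) a' (c₁ := c₁) x⟫_ℂ)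
    (hpos1 : ∀ x : SiteL2K ℂ d (fineP (L ^ (n + 1)) m) c₀ W, x ≠ 0 →
      0 < RCLike.re ⟪x, laplacePrimeA (L ^ (n + 1)) m φ η (fun _ : Bond d (fineP (L ^ (n + 1)) m) => (1 : 𝔸ˣ)) a' (c₁ := c₁) x⟫_ℂ) :
    GpOfUk L m n φ η (fun _ : Bond d (towerP L m (n + 1)) => (1 : 𝔸ˣ)) a' (c₁ := c₁) hposk =
      (siteL2Cast ℂ h).symm.toLinearMap ∘ₗ
        GpOfU (L ^ (n + 1)) m φ η (fun _ : Bond d (fineP (L ^ (n + 1)) m) => (1 : 𝔸ˣ)) a' (c₁ := c₁) hpos1 ∘ₗ (siteL2Cast ℂ h).toLinearMap :=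
  LinearMap.ext fun x => GpOfUk_one_apply L m n φ η a' h hposk hpos1 x

end Flat

end Literature.MathematicalPhysics.QuantumFieldTheory.Balaban1983to89.B9Eq324DeltaPrimeATower

end
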